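import Summits.BirchSwinnertonDyer.BirchSwinnertonDyer.Theses.ErratumRoadFive
import Summits.BirchSwinnertonDyer.BirchSwinnertonDyer.Theorems.ErratumRoadFiveEulerHalfPOnlyMultOfJetchevAtP
import Summits.BirchSwinnertonDyer.BirchSwinnertonDyer.Theorems.Rank1ResidualJetCarrierMult
import Summits.BirchSwinnertonDyer.Rank1Residual.JET.CarrierEndFormsGross1991
import Literature.NumberTheory.EllipticCurves.HeegnerPointsOfConductorOneGaloisConjProofs
import Literature.NumberTheory.EllipticCurves.HeegnerPointsOfConductorOneRationalityProofs

/-!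
# Line `jetchev_at_p` (v3) — crux `ErratumRoadFive.EulerHalfNotRamNoInertSetAtFive` (item stmt-BirchSwinnertonDyer-19715)
# The 334-pair core of the crux, KERNEL-REDUCED to ONE reading of the JET cell — K5 `JET.JetchevCoreVertexExistence` (Jetchev Prop. 5.3, core
# vertices, read at p ∣ N) — plus FIVE PRINTED theorems by name; i.e. to exactly the mathematical content of the commissioned `p = 3 → p` port

Seat `bsd-idea-9` (planner; D-0154 KEY (146) §B ideator pair B, lens = complete = program-completion), g2, 2026-08-28T07:4xZ. A SECOND line beside
the line of record `Lines/birth.lean` v4 (lead `bsd-line-er5-p1`; registered by plan g40 07:01Z, commit 513404f5cf50; NOT re-registered by this seat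
— W-79) and `Lines/ubB.lean`. Crux idea card: `Ideas/jetchev-at-p.md`. BSD is proved for no pair by this file; item 19715 is NOT closed; nothing is
booked; no summit statement is proved by this seat.

## v3 (same path; supersedes v2 00967b98eed844b1 ∕ 5fc4804bcecf) — what changed and why

INPUTS SINCE v2: critic idea-crit-14 VERDICT #10 (06:58Z, PASS-WITH-PRICE; P1 LOAD-BEARING: v2's `_proof (h₅ h₃ hMcC)` was class `proof.conditional` on the
UNREGISTERED hypothesis `hMcC` = [McC91] Cor. 5.6, so v2 would not close 19715 even with its stubs proved; P2 K3's open column must be explicit; P3 name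
the seams of v2's descent stub); lead er5-p1's v4 (07:01Z: road J = deciding stub `Birth.stub_jetchevAtP` = -w2's binder `hJ` VERBATIM, RULING 50) and
PORT-SPEC (07:04Z: the `p = 3` twin `Koly.jetchevMaxHLAtThree_of_facts_of_print` is a kernel theorem modulo SIX PRINTED facts with «NO core-vertex binder»;
S1b := PORT of ≈15 AT-3 modules); tam3-p1 g14 (07:18Z: (r1) EMPTY, every engine `p`-generic); plan g40 RULING 52′ (07:27Z: v5 deciding stub := the
port's consumer target (B); `hJ` stays lines_any).

WHAT v3 DOES (all kernel-checked in this file, sorries ONLY in the three stubs):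
(1) P1 PAID — the composition `EulerHalfNotRamNoInertSetAtFive_of (h₅ h₃) (hS0 hS1 hS2)` takes ONLY the two route items `PublishedInputsFive` (19066) ∕
    `X11aLowerHalf` (19064) and the three declared stub statements; `_proof (h₅ h₃)` is audit class proof-of-item (v2: proof.conditional).
(2) THE CUT IS ONE LEVEL DEEPER THAN v2 AND LANDS ON THE PORT'S CONTENT. v2's descent stub is GONE — both its halves are tree theorems: the `K`-half is
    the JET cell's `JET.sha_card_add_tamagawa_le_index_of_carrierMult` (K3 + [McC] Cor. 5.6 + Kolyvagin + Shimura reciprocity at conductor 1 + Darmon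
    Thm. 3.6, the last two PROVED Literature theorems) and the `ℚ`-half is -w2's chain, whose single use of `hJ` is at the globally-minimal ∕ `N = N_E` ∕
    `|d_K| > 4` ∕ `p ≥ 5` multiplicative-surjective instance = `JetchevAtPFlat` (hJ♭) below (§3 re-runs it with hJ♭; one changed line; credit -w2). And K3
    itself is the JET cell's `JET.jetchevDivisibilityCarrierMult_of_namedPrintGross1991 h52 hCV h44 hPT hF1` — four PRINTED facts (the same [McC] 5.2,
    [McC] 4.4, Poitou–Tate, Gross 91 F1 that the `p = 3` chain uses) plus K5. HENCE (theorem `res_pOnlyMultCarrierAtFive_of_K5_of_print_of_items`,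
    sorry-free): the line of record's S1b (334 ∕ 404 pairs) VERBATIM ⟸ route items + `PrintedInputsJET` (five printed theorems by name) + K5.
(3) STUBS: S0 `stub_printedInputsJET` (the five printed theorems BY NAME, one conjunction like the route's `PublishedInputsFive`) · S1 DECIDING
    `stub_jetK5_coreVertex` := `JET.JetchevCoreVertexExistence` BY NAME · S2 `stub_res_otherMultAtFive` := plan g26's v1 residual VERBATIM (lead's territory:
    closed on the line of record modulo its road ∕ S2b ∕ held-primitives stubs).
(4) WHAT THIS SAYS ABOUT THE PORT (for lead ∕ plan ∕ director; their call — RULING 50 ∕ 52′ stand, this line stays lines_any): the AT-3 chain has no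
    core-vertex binder because the x11b3 ∕ tam3 WALK files CONSTRUCT Jetchev's core vertex at 3 from print; everything else the port would carry
    ([McC] 5.2 ∕ 4.4 plumbing, duality, Prop. 4.9 at the carrier, Thm. 6.3, the `E₀`-receptacle from F1, Cor. 5.6, the `ℚ`-descent) is ALREADY `p`-generic
    kernel mathematics in `Theorems/Rank1ResidualJet*` + -w2's files + this file. So, seen through the JET column, THE PORT'S MATHEMATICAL CONTENT IS K5 AT
    MULTIPLICATIVE `p`. Typing the port's core-vertex layer to conclude `JET.JetchevCoreVertexExistence` (by name, `p`-generic; if the walk needs the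
    Manin-good ∕ `Odd d_K` ∕ `L(E^{d_K},1) ≠ 0` ∕ `p ∤ Dt.c` frame guards of PORT-SPEC (A), then K5 RESTRICTED to them — §3's consumer lives on such a frame)
    makes ONE ported object close S1b here (via this file) AND the JET buckets A ∕ B ∕ B-add (K1 ∕ K3 ∕ K4 end forms `…_of_namedPrintGross1991`) by name —
    one object, many consumers — where target (A)∕(B) serves 19715 alone. Numbers: 19715 = 404 pairs = 69 (road, stub LANDED p611250) + 334 (S1b ⟸ K5 +
    print, this file) + 1 (S2b).
(5) TYPING FINDING (unchanged from the v3 plan, documented by `hJ_implies_hJflat`): v4's `stub_jetchevAtP` VERBATIM over-quantifies relative to its one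
    consumer (additive `p ∣ N`, `p = 3`, non-minimal `W`, `d_K ∈ {−3,−4}`, `N ≠ N_E` asserted, never consumed); RULING 52′ already retypes v5's stub.

OPEN COLUMN after v3 (honest; critic P2): S0 = five NAMED PRINT facts (Literature `def`s, unproved in the tree: [McC] Prop. 5.2, Prop. 4.4, Cor. 5.6;
Poitou–Tate for Selmer structures; Gross 91 §6 F1) — plus, inside `PublishedInputsFive`, Gross–Zagier, Kolyvagin, GZK, modularity, newforms,
Friedberg–Hoffstein, Mazur's Manin bound; S1 = K5, a READING («NOT a published statement»: [J] Prop. 5.3 is printed under Hypothesis (∗) `p ∤ N`; the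
cell's D-audit finds no `p`-versus-`N` input in its proof, sheets PV1-A §2 row 9 ∕ PV2-J6 §3 (iv); at `p = 3 ∥ N` the tree PROVES it inside the AT-3
walk); S2 = the residual by name. Composition sorry-free; hypotheses = route items + declared stubs.

PROBES (theorem-free files, `#h21_crux_probe … summit := <crux decl>`; HOME lines/probe19715_v3*.raw.txt): [McC] Cor. 5.6 by name CLEAN · hJ♭ CLEAN ·
S2 CLEAN · K5 by name CLEAN (P1∕P2∕P2h∕P3∕P5 ok) · `PrintedInputsJET` CLEAN; K3 CLEAN (v2 record). No stub implies the crux cheaply; none is vacuous.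

[cite: Jetchev2008, Hypothesis (*), Thm. 1.4, Cor. 1.5, Lemma 4.3, Prop. 4.9, Prop. 5.3 (p. 823, proof pp. 823–824), Thm. 6.3 (arXiv:math/0703431 pp. 3, 9, 13, 15; Compos. Math. 144 p. 812)]
[cite: McCallumLMS1991, §3 Cor. 3.2, Prop. 4.4, Lemma 5.1 (p. 303), Prop. 5.2, Cor. 5.6 (p. 310)] [cite: GrossZagier1986, I (6.3), III (3.1)] [cite: GrossLMS1991, Prop. 6.2 (1) (p. 245), §4 (4.1)]
[cite: Darmon2004, Thm. 3.6, Thm. 3.7] [cite: MilneADT2006, Ch. I, Thm. 4.10(b)] [cite: Miller2011LMS, Def. 1.1, Thm. 5.4] [cite: Mazur1978, Cor. 4.1] [cite: FriedbergHoffstein1995, Thm. B] [cite: Wuthrich2014, Lemma 20]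
-/

set_option autoImplicit false
set_option linter.dupNamespace false

noncomputable section

open scoped Classical NumberField

open WeierstrassCurve NumberField IsDedekindDomain Rat.HeightOneSpectrum
open Literature.NumberTheory.EllipticCurves
open Literature.NumberTheory.EllipticCurves.ModularForms
open Literature.NumberTheory.EllipticCurves.Rank1Residual
open Literature.NumberTheory.EllipticCurves.Rank1Residual.Typed
open Literature.NumberTheory.EllipticCurves.KrizLi2019
open Literature.NumberTheory.Automorphic
open Summit.BirchSwinnertonDyer.Rank1Residual Summit.BirchSwinnertonDyer.Rank1Residual.X11b
open Summit.BirchSwinnertonDyer.BirchSwinnertonDyer.Theorems.JetchevAtP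
open Summit.BirchSwinnertonDyer.BirchSwinnertonDyer.Theses.ErratumRoadFive

namespace Summit.BirchSwinnertonDyer.BirchSwinnertonDyer.Cruxes.EulerHalfNotRamNoInertSetAtFive.JetchevAtP

/-! ## §0 The consumed instance hJ♭ of road J's binder -/

/-- **hJ♭ `JetchevAtPFlat` — Jetchev 2008 Cor. 1.5 in `K`-form at the multiplicative carrier `q := p`, in EXACTLY the generality road J consumes:**
`W/ℚ` globally minimal, level `N = N_E`, `K` imaginary quadratic Heegner for `N_E` with `d_K ∉ {−3,−4}`, `p ≠ 2` of MULTIPLICATIVE reduction with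
`ρ̄_{E,p}` onto, `P ∈ E(K)` a Heegner point of infinite order: `ord_p #Ш(E/K) + 2·ord_p c_p(E) ≤ 2·ord_p [E(K):ℤP]`. A restriction of the line of
record's `Birth.stub_jetchevAtP` (`hJ_implies_hJflat`); derived below from K3 + [McC] Cor. 5.6 (`jetchevAtPFlat_of_K3_of_mcCallum`). Beyond print as a
statement (Jetchev's Hypothesis (∗) has `p ∤ N`), implied by BSD(E/K)_p; asserted nowhere. [cite: Jetchev2008, Cor. 1.5 (p. 812)] -/
@[conjecture] def JetchevAtPFlat : Prop :=
  ∀ (W : WeierstrassCurve ℚ) [W.IsElliptic] [W.IsGloballyMinimal] [NeZero (W.conductorNorm ℤ)]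
    (K : Type) [Field K] [NumberField K], IsImaginaryQuadratic K →
    NumberField.discr K ≠ -3 → NumberField.discr K ≠ -4 →
    SatisfiesHeegnerHypothesis (W.conductorNorm ℤ) K →
    ∀ (p : ℕ) [Fact p.Prime], p ≠ 2 → W.HasMultiplicativeReductionAtPrime p → W.HasSurjectiveModNGaloisRep p →
    ∀ {P : (W.baseChange K).toAffine.Point}, IsHeegnerPoint (W.conductorNorm ℤ) W K P → ¬ IsOfFinAddOrder P →
      padicValNat p (Nat.card (W.baseChange K).sha) +
          2 * padicValNat p ((W.baseChange ℚ_[p]).localTamagawaNumber ℤ_[p]) ≤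
        2 * padicValNat p (AddSubgroup.zmultiples P).index

/-- hJ ⇒ hJ♭: the line of record's `Birth.stub_jetchevAtP` (its statement, = -w2's `hJ`) implies `JetchevAtPFlat` (instance `N := N_E`; a
multiplicative `p` divides `N_E`). Documents that v3's binder is WEAKER than v4's deciding stub. -/
theorem hJ_implies_hJflat
    (hJ : ∀ (N : ℕ) [NeZero N] (W : WeierstrassCurve ℚ) (K : Type) [Field K] [NumberField K] [W.IsElliptic],
      IsImaginaryQuadratic K → SatisfiesHeegnerHypothesis N K →
      ∀ {P : (W.baseChange K).toAffine.Point}, IsHeegnerPoint N W K P → ¬ IsOfFinAddOrder P →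
      ∀ {p : ℕ} [Fact p.Prime], p ≠ 2 → W.HasSurjectiveModNGaloisRep p → p ∣ N →
        padicValNat p (Nat.card (W.baseChange K).sha) +
            2 * padicValNat p ((W.baseChange ℚ_[p]).localTamagawaNumber ℤ_[p]) ≤
          2 * padicValNat p (AddSubgroup.zmultiples P).index) :
    JetchevAtPFlat := by
  intro W _ _ _ K _ _ hK _ _ hH p _ hp2 hmult hsurj P hP hnt
  have hpN : p ∣ W.conductorNorm ℤ :=
    (W.dvd_conductorNorm_iff_not_hasGoodReductionAtPrime p).mpr
      (WeierstrassCurve.HasMultiplicativeReduction.not_hasGoodReduction (R := ℤ_[p]) hmult)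
  exact hJ (W.conductorNorm ℤ) W K hK hH hP hnt hp2 hsurj hpN

/-! ## §1 The stubs -/

/-- **`PrintedInputsJET` — the FIVE PRINTED theorems the JET column rests on, BY NAME (Literature named facts, cite-only `def`s, each
unproved in the tree; a conjunction exactly like the route's own item `PublishedInputsFive`):** [McC91] Prop. 5.2 (Čebotarev supply of Kolyvagin
conductors with prescribed class order) · [McC91] Prop. 4.4 (local order of the Kolyvagin class = order of the derivative point) · Poitou–Tate duality
for Selmer structures (Milne ADT I 4.10 ∕ Howard 2.1.11; typed as a conjecture-def) · Gross 1991 §6 ∕ [GZ86 III (3.1)] (`y − y^σ − torsion ∈ E₀`,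
the Literature FACT F1 that replaces the receptacle schema, `JET.forall_hGZ_of_Gross1991`) · [McC91] §5 Cor. 5.6 (structure theorem: global
`p^s`-divisibility of the derived points for `s ≤ t` ⟹ `ord_p #Ш(E/K)[p^∞] + 2t ≤ 2M₀`). The first four are EXACTLY four of the six printed facts of the
`p = 3` kernel chain `Koly.jetchevMaxHLAtThree_of_facts_of_print` (p547155; its other two, Gross–Zagier and modularity, are conjuncts of `PublishedInputsFive`).
[cite: McCallumLMS1991, Prop. 4.4, Prop. 5.2, Cor. 5.6 (p. 310)] [cite: GrossLMS1991, §6 Prop. 6.2 (1)] [cite: GrossZagier1986, III (3.1)] [cite: MilneADT2006, Ch. I, Thm. 4.10(b)] -/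
def PrintedInputsJET : Prop :=
  Literature.NumberTheory.EllipticCurves.McCallum1991.prop52_exists_conductor_kolyvaginClass_order_eq ∧
  Literature.NumberTheory.EllipticCurves.McCallum1991.prop44_localOrder_kolyvaginClass_mul_eq ∧
  (∀ (K : Type) [Field K] [NumberField K], Literature.NumberTheory.GaloisCohomology.poitouTate_selmerStructure_duality_conj K) ∧
  Literature.NumberTheory.EllipticCurves.Gross1991_heegnerPoint_sub_ratTorsion_mem_E0 ∧
  Literature.NumberTheory.EllipticCurves.McCallum1991_padicValNat_card_sha_primary_add_le_of_globalDivisibility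

/-- **STUB S0 · `stub_printedInputsJET` — the five printed theorems BY NAME** (`PrintedInputsJET`). NAMED PRINT, unproved in the tree (formalising
them = McCallum §§3–5 + Poitou–Tate for Selmer structures + Gross 91 §6: XL in total, each a typing∕formalisation task of a PUBLISHED proof, none a
research question). Declared as a stub so that the composition takes only route items + declared stubs (critic V10 P1: in v2 [McC] Cor. 5.6 was an
unregistered hypothesis `hMcC`, class `proof.conditional`). Why it might fail: only as a typing slip of one of the five Literature defs.
[cite: McCallumLMS1991, Prop. 4.4, Prop. 5.2, Cor. 5.6] [cite: GrossLMS1991, Prop. 6.2 (1)] [cite: MilneADT2006, I Thm. 4.10(b)] -/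
theorem stub_printedInputsJET : PrintedInputsJET := by
  sorry

/-- **STUB S1 (DECIDING for the 334-pair core) · `stub_jetK5_coreVertex` — the JET cell's reading binder K5 `JET.JetchevCoreVertexExistence` BY NAME:**
Jetchev 2008 Prop. 5.3 (existence of GLOBAL CORE VERTICES of every level `m ≥ 1` above a Kolyvagin conductor carrying a non-torsion, exactly
`p^s`-divisible derived point, `s + m ≤ M(c)`), read with «`p ∤ N`» DROPPED and the mod-`p` image replaced by the `p`-adic tower — the ONE non-print
input of the whole JET column {K1, K3, K4} (Rank1ResidualJetDefs.lean l.300–345: «with it the three binders K1 ∕ K3 ∕ K4 reduce to McCallum Prop. 5.2,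
K5, and the KERNEL instantiation of Thm. 6.3»). WHY THIS IS THE RIGHT DECIDING OBJECT (v3, 07:3xZ, after lead er5-p1's PORT-SPEC 07:04Z and plan g40's
RULING 52′ 07:27Z): the `p = 3` chain `Koly.jetchevMaxHLAtThree_of_facts_of_print` has «NO core-vertex binder» because x11b3∕tam3's WALK files
(`…EulerHalvesAtThreeCoreVertex*`, `…Walk*`, `…KolyvaginRedefinition`) CONSTRUCT the core vertex at 3 from print; tam3-p1 g14 certifies (r1) EMPTY — every
engine is `p`-generic. Hence THE MATHEMATICAL CONTENT OF THE COMMISSIONED PORT (PORT-SPEC §2, ≈15 AT-3 modules), SEEN THROUGH THE JET COLUMN, IS K5 AT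
MULTIPLICATIVE `p` — and this file proves (sorry-free, `res_pOnlyMultCarrierAtFive_of_K5_of_print_of_items`) that K5 + `PrintedInputsJET` + the route
items already give the line of record's S1b VERBATIM. Typing the port's core-vertex layer to conclude `JET.JetchevCoreVertexExistence` (by name,
`p`-generic) instead of ∕ in addition to the 19715-specific HL target (A) makes ONE ported object close S1b here AND JET buckets A∕B∕B-add (K1∕K3∕K4 end
forms `JET.jetchevDivisibilityCarrier{Ne,Mult,Add}_of_namedPrintGross1991`) by name — one object, many consumers. Why plausibly true: Jetchev's printed
proof of Prop. 5.3 (pp. 823–824) uses only the self-dual Kummer structure, [McC] Cor. 3.2 (image), the lozenge Lemma 3.4, Prop. 4.4 and `H⁰ = 0` — no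
`p`-versus-`N` input (cell bsd-jet D-audit sheets PV1-A §2 row 9, PV2-J6 §3 (iv)); and at `p = 3 ∥ N` the tree PROVES it. Why it might fail: a frame
mismatch only — K5 quantifies over every Kolyvagin datum `(Dt, β, ι)` with the tower and `d_K ∉ {−3,−4}`, the AT-3 walk is stated on Manin-good conductor-1
frames with `Odd d_K`, `L(E^{d_K},1) ≠ 0`, `p ∤ Dt.c` (PORT-SPEC (A)); if the ported walk needs those frame guards, the by-name target is K5 RESTRICTED to
them (still enough here: §3's consumer works on exactly such a frame). Size: XL unconditional ∕ = the port (engineering, (r1) EMPTY) modulo print.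
[cite: Jetchev2008, Prop. 5.3 (p. 823) and its proof (pp. 823–824), Thm. 1.4, Thm. 6.3] [cite: McCallumLMS1991, §3 Cor. 3.2, §4 Prop. 4.4, §5 Prop. 5.2] -/
theorem stub_jetK5_coreVertex : Summit.BirchSwinnertonDyer.Rank1Residual.JET.JetchevCoreVertexExistence := by
  sorry

/-- **STUB S2 (honest residual, BY NAME) · `stub_res_otherMultAtFive` — the pairs of the crux with a SECOND multiplicative prime `ℓ ≠ p`:**
plan g26's v1 piece S2 of the line of record VERBATIM (the crux's binders + «some multiplicative `ℓ ≠ p`»; census: 70 R1b pairs below 5·10⁵).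
On the line of record v4 this statement is CLOSED MODULO its stubs `stub_splitSetRoadAtFive` (the landed split-set road + the `q = 2` clause; 69 ∕ 70
pairs), `stub_res_otherMultNoSplitDatumAtFive` (S2b: (129360cy1, 5)) and `stub_shimuraSplitPrimitivesHeld`, together with the route items
`ShimuraParametrizationDataNonempty` ∕ `PastenComponentOrdersInput` ∕ `ShimuraCasselsTateLevelInputs` — by v4's own `_of` (case split on the split-set
datum). This line adds nothing there and does not duplicate it: S2 is the lead's territory by name. Why it might fail: exactly where BSD(E,p)'s Euler
half fails on such a pair. [cite: JetchevSkinnerWan2017, §7.4.2, Thm. 4.4.1] [cite: PastenShimura2024, L6.15, L6.16, L6.18] [cite: Kim2024TAMS, Thm. 4.3] -/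
theorem stub_res_otherMultAtFive :
    ∀ (W : WeierstrassCurve ℚ) [W.IsElliptic] [W.IsGloballyMinimal] (p : ℕ) [Fact p.Prime],
      ClassX11b W p → 5 ≤ p → Surj W p → ¬ Ram W p → p ∣ W.tamagawaProduct →
      (∃ ℓ : ℕ, ∃ _ : Fact ℓ.Prime, ℓ ≠ p ∧ W.HasMultiplicativeReductionAtPrime ℓ) →
      ¬ (∃ S : Finset ℕ, (∀ ℓ ∈ S, ∃ _ : Fact ℓ.Prime, Mult W ℓ) ∧ Even S.card ∧ p ∈ S ∧
          (∀ (ℓ : ℕ) [Fact ℓ.Prime], ℓ ∉ S → W.HasSplitMultiplicativeReductionAtPrime ℓ →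
            ¬ p ∣ padicValInt ℓ W.minimalDiscriminantInt) ∧
          (¬ p ∣ padicValInt p W.minimalDiscriminantInt ∨
            ∃ R ⊆ S, S.card = 2 * R.card ∧ ∀ q ∈ R, q ≠ 2 ∧ ¬ p ∣ q - 1)) →
      Typed.MissingUpperBoundAt W p := by
  sorry

/-! ## Stub statements by name -/

namespace Statement

/-- Statement of `stub_printedInputsJET` (= `PrintedInputsJET`, five Literature named facts). -/
abbrev stub_printedInputsJET : Prop := type_of% @JetchevAtP.stub_printedInputsJET
/-- Statement of `stub_jetK5_coreVertex` (= `JET.JetchevCoreVertexExistence`). -/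
abbrev stub_jetK5_coreVertex : Prop := type_of% @JetchevAtP.stub_jetK5_coreVertex
/-- Statement of `stub_res_otherMultAtFive` (= plan g26's v1 `Birth.stub_res_otherMultAtFive`, verbatim). -/
abbrev stub_res_otherMultAtFive : Prop := type_of% @JetchevAtP.stub_res_otherMultAtFive

end Statement

/-! ## §2 hJ♭ from the JET column (sorry-free): K3 + [McC] Cor. 5.6 + Kolyvagin + two PROVED Literature theorems -/

/-- **`jetchevAtPFlat_of_K3_of_mcCallum` — hJ♭ ⟸ {K3, [McC] Cor. 5.6} + Kolyvagin** (the conjunct `kolyvagin` of `PublishedInputsFive`: rank one and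
`Ш(E/K)` finite from a Heegner point of infinite order). One call of the JET cell's `JET.sha_card_add_tamagawa_le_index_of_carrierMult`
(Theorems/Rank1ResidualJetCarrierMult.lean §2, kernel-checked) with Shimura reciprocity at conductor 1 (`heegnerPointOfConductor_one_galoisConj_holds`,
Darmon Thm. 3.7 ∕ Gross 91 §4 — PROVED) and Darmon 2004 Thm. 3.6 (`phi_heegnerTau_mem_singularModuliField_holds` — PROVED), the `p`-adic tower from
mod-`p` surjectivity at the multiplicative odd `p` (`forall_hasSurjectiveModNGaloisRep_pow_of_multiplicative_of_surj`, Serre IV-23 ∕ Wuthrich L.20).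
CONDITIONAL on K3 and Cor. 5.6 only. [cite: Jetchev2008, Cor. 1.5 (p. 812)] [cite: McCallumLMS1991, Lemma 5.1, Cor. 5.6] [cite: Darmon2004, Thm. 3.6, Thm. 3.7] -/
theorem jetchevAtPFlat_of_K3_of_mcCallum
    (hKo : ∀ (N : ℕ) [NeZero N] (W : WeierstrassCurve ℚ) (K : Type) [Field K] [NumberField K], kolyvagin N W K)
    (hK3 : Summit.BirchSwinnertonDyer.Rank1Residual.JET.JetchevDivisibilityCarrierMult)
    (hMcU : Literature.NumberTheory.EllipticCurves.McCallum1991_padicValNat_card_sha_primary_add_le_of_globalDivisibility) :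
    JetchevAtPFlat := by
  intro W _ _ _ K _ _ hK hD3 hD4 hH p _ hp2 hmult hsurj P hP hnt
  exact Summit.BirchSwinnertonDyer.Rank1Residual.JET.sha_card_add_tamagawa_le_index_of_carrierMult hK3 hMcU W K
    (hKo _ W K) (heegnerPointOfConductor_one_galoisConj_holds _ W K) (phi_heegnerTau_mem_singularModuliField_holds _ W K)
    hK hD3 hD4 hH p hp2 hmult
    (fun n ↦ WeierstrassCurve.forall_hasSurjectiveModNGaloisRep_pow_of_multiplicative_of_surj W p hp2 hmult hsurj n) hP hnt

/-- **K3 ⟸ K5 + print, BY NAME** — the JET cell's `JET.jetchevDivisibilityCarrierMult_of_namedPrintGross1991` (Rank1Residual/JET/CarrierEndFormsGross1991.lean: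
{[McC] Prop. 5.2, K5, [McC] Prop. 4.4, Poitou–Tate, Gross 91 F1}; the receptacle schema `hGZ` fed from F1 by `JET.forall_hGZ_of_Gross1991`). One line; here so
that the composition displays K5, not K3, as the open reading. [cite: Jetchev2008, Thm. 1.4, Thm. 5.2, Prop. 4.9, Prop. 5.3] -/
theorem k3_of_K5_of_print (hP : PrintedInputsJET) (hK5 : Summit.BirchSwinnertonDyer.Rank1Residual.JET.JetchevCoreVertexExistence) :
    Summit.BirchSwinnertonDyer.Rank1Residual.JET.JetchevDivisibilityCarrierMult :=
  Summit.BirchSwinnertonDyer.Rank1Residual.JET.jetchevDivisibilityCarrierMult_of_namedPrintGross1991 hP.1 hK5 hP.2.1 hP.2.2.1 hP.2.2.2.1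

/-- **hJ♭ ⟸ K5 + the five printed theorems + Kolyvagin** (sorry-free): `k3_of_K5_of_print` then `jetchevAtPFlat_of_K3_of_mcCallum`. Modulo PRINT the one
open input of Jetchev Cor. 1.5 at the multiplicative carrier `q = p`, in the generality road J consumes, is K5. [cite: Jetchev2008, Cor. 1.5, Prop. 5.3] -/
theorem jetchevAtPFlat_of_K5_of_print
    (hKo : ∀ (N : ℕ) [NeZero N] (W : WeierstrassCurve ℚ) (K : Type) [Field K] [NumberField K], kolyvagin N W K)
    (hP : PrintedInputsJET) (hK5 : Summit.BirchSwinnertonDyer.Rank1Residual.JET.JetchevCoreVertexExistence) :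
    JetchevAtPFlat :=
  jetchevAtPFlat_of_K3_of_mcCallum hKo (k3_of_K5_of_print hP hK5) hP.2.2.2.2

/-! ## §3 -w2's `ℚ`-descent re-run with hJ♭ (adapted from Theorems/ErratumRoadFiveEulerHalfJetchevAtPDefect.lean §3–§4; one changed line) -/

/-- **-w2's `padicValNat_shaOrder_add_le_of_rankOne_of_lowerTwists_of_jetchevAtP` with the binder weakened to hJ♭.** Rank one, `p ≥ 5` multiplicative,
`E[p]` irreducible, `ρ̄` onto: `#Ш(E)_an = q ∈ ℚ` with `ord_p #Ш(E) + 2·ord_p c_p(E) ≤ ord_p q + 2·ord_p ∏_ℓ c_ℓ(E)`, modulo the rank-zero Heegner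
twists' lower halves. Proof VERBATIM -w2's (Manin-unit datum with `p ∤ c` since `p² ∤ N`; Friedberg–Hoffstein field with `|d_K| > 4`, `p` split,
`L(E^{d_K},1) ≠ 0`; Heegner datum and point; minimal twist model; the slack engine `padicValNat_shaOrder_add_le_of_shaIndexBoundSlack`) except the last
line, where hJ♭ is applied at `(W, N_E, K, p, P)` with `d_K ≠ −3, −4` read off `|d_K| > 4`. CONDITIONAL on hJ♭; nothing booked.
-- adapted from Summits/BirchSwinnertonDyer/BirchSwinnertonDyer/Theorems/ErratumRoadFiveEulerHalfJetchevAtPDefect.lean (seat bsd-line-er5-p1-w2)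
[cite: Jetchev2008, Cor. 1.5 (arXiv p. 3)] [cite: Miller2011LMS, Thm. 5.4 (p. 11) and Def. 1.1] [cite: McCallumLMS1991, §1 Theorem (Kolyvagin), p. 296] [cite: Mazur1978, Cor. 4.1] -/
theorem padicValNat_shaOrder_add_le_of_rankOne_of_lowerTwists_of_hJflat
    (hGZ : ∀ (N : ℕ) [NeZero N] (W : WeierstrassCurve ℚ) (K : Type) [Field K] [NumberField K],
      gross_zagier N W K)
    (hKo : ∀ (N : ℕ) [NeZero N] (W : WeierstrassCurve ℚ) (K : Type) [Field K] [NumberField K],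
      kolyvagin N W K)
    (hGZK : rank_eq_analyticRank_of_analyticRank_le_one) (hmod : hasEntireLFunction_rat)
    (hnf : exists_isNewformOf) (hFH : friedbergHoffstein_exists_heegnerField_split_twist_ne_zero)
    (hMaz : mazur_not_dvd_maninConstant_of_odd)
    (hJ : JetchevAtPFlat)
    (W : WeierstrassCurve ℚ) [W.IsElliptic] [W.IsGloballyMinimal] (p : ℕ) [Fact p.Prime]
    [NeZero (W.conductorNorm ℤ)]
    (hmult : Mult W p) (hirr : Irr W p) (hsurj : Surj W p) (hp5 : 5 ≤ p) (hr : W.analyticRank = 1)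
    (hlow : ∀ (K : Type) [Field K] [NumberField K] (Wd : WeierstrassCurve ℚ) [Wd.IsElliptic]
      [Wd.IsGloballyMinimal], IsImaginaryQuadratic K →
      SatisfiesHeegnerHypothesis (W.conductorNorm ℤ) K → SatisfiesHeegnerHypothesis p K →
      (∃ C : VariableChange ℚ, C • W.quadraticTwist (NumberField.discr K : ℚ) = Wd) →
      Wd.analyticRank = 0 → MissingLowerBoundAt Wd p) :
    ∃ q : ℚ, shaAn W = (q : ℂ) ∧
      (padicValNat p W.shaOrder : ℤ) + 2 * padicValNat p ((W.baseChange ℚ_[p]).localTamagawaNumber ℤ_[p]) ≤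
        padicValRat p q + 2 * padicValNat p W.tamagawaProduct := by
  -- adapted from Summits/BirchSwinnertonDyer/BirchSwinnertonDyer/Theorems/ErratumRoadFiveEulerHalfJetchevAtPDefect.lean
  have hNS : integral_neronScaling_of_isGloballyMinimal := integral_neronScaling_of_isGloballyMinimal_holds
  have hp : p.Prime := Fact.out
  have hp2 : p ≠ 2 := by omega
  have hpN2 : ¬ p ^ 2 ∣ W.conductorNorm ℤ := not_sq_dvd_conductorNorm_of_mult W p hmult
  obtain ⟨D, hc⟩ := X11b.exists_modularParametrizationData_not_dvd hnf hMaz hNS W rfl hp hp2 hpN2 hirr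
  have hw : W.rootNumber = -1 := by
    rw [WeierstrassCurve.rootNumber_eq_neg_one_pow_analyticRank_of_exists_isNewformOf hnf W, hr]
    norm_num
  obtain ⟨K, _, _, hK, hdisc, hHN, hHp, hLt⟩ := hFH W hw p hp 4
  have h4 : NumberField.discr K < -4 := by
    haveI : IsTotallyComplex K := hK.2
    have hneg : NumberField.discr K < 0 := discr_neg_of_finrank_eq_two K hK.1
    have habs : ((NumberField.discr K).natAbs : ℤ) = -NumberField.discr K :=
      Int.ofNat_natAbs_of_nonpos hneg.le
    have : (4 : ℤ) < ((NumberField.discr K).natAbs : ℤ) := by exact_mod_cast hdisc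
    omega
  have hD3 : NumberField.discr K ≠ -3 := by omega
  have hD4 : NumberField.discr K ≠ -4 := by omega
  have hμ : ¬ p ∣ Units.torsionOrder K := by
    haveI : IsTotallyComplex K := hK.2
    rw [Literature.NumberTheory.DiophantineGeometry.torsionOrder_eq_two_of_discr_lt hK.1 h4]
    intro h2
    have := Nat.le_of_dvd two_pos h2
    omega
  obtain ⟨β, hβ⟩ := exists_dvd_sq_sub_discr_holds (W.conductorNorm ℤ) K hK hHN
  obtain ⟨H, -⟩ := nonempty_heegnerDatum_holds (W.conductorNorm ℤ) K hK hβ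
  obtain ⟨ι⟩ : Nonempty (K →+* ℂ) := inferInstance
  obtain ⟨P, hP⟩ := heegnerPointComplex_mem_range_map_holds (W.conductorNorm ℤ) W K hK hHN D H ι
  have hD0 : (NumberField.discr K : ℚ) ≠ 0 := by exact_mod_cast NumberField.discr_ne_zero K
  haveI hEt : (W.quadraticTwist (NumberField.discr K : ℚ)).IsElliptic :=
    W.isElliptic_quadraticTwist hD0
  obtain ⟨Cd, hCd⟩ := hasGlobalMinimalModel_rat_holds (W.quadraticTwist (NumberField.discr K : ℚ))
  haveI : (Cd • W.quadraticTwist (NumberField.discr K : ℚ)).IsGloballyMinimal := hCd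
  set Wd : WeierstrassCurve ℚ := Cd • W.quadraticTwist (NumberField.discr K : ℚ) with hWd_def
  have hWd : Cd • W.quadraticTwist (NumberField.discr K : ℚ) = Wd := rfl
  have hrd : Wd.analyticRank = 0 := by
    rw [hWd_def, analyticRank_smul]
    exact analyticRank_eq_zero_of_entireLFunction_one_ne_zero _ hLt
  have hlowd : MissingLowerBoundAt Wd p := hlow K Wd hK hHN hHp ⟨Cd, rfl⟩ hrd
  -- transports to the twist model
  have hirrd : Wd.HasIrreducibleModPGaloisRep p :=
    X11b.hasIrreducibleModPGaloisRep_twist_model W p K hK.1 hirr Cd hWd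
  have htam : padicValNat p Wd.tamagawaProduct = padicValNat p W.tamagawaProduct :=
    X11b.padicValNat_tamagawaProduct_twist_of_heegner W p hp5 K hK hHN Cd hWd
  have hu : padicValRat p (Cd.u : ℚ) = 0 :=
    AdditivePotMult.padicValRat_u_eq_zero_of_twist_minimal_of_split W p K hK hHp Cd hWd
  obtain ⟨qd, hqd, hvqd⟩ :=
    AdditivePotMult.exists_printShape_lower_of_missingLowerBoundAt_rankZero (p := p) Wd hGZK hrd hirrd hlowd
  exact padicValNat_shaOrder_add_le_of_shaIndexBoundSlack W p (W.conductorNorm ℤ) K D H ι P (hGZ _ W K)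
    (hKo _ W K) hGZK hmod hK hHN hP hp2 hc hμ hr hLt Wd Cd hWd hu htam ⟨qd, hqd, hvqd⟩ _
    (fun _ hnt ↦ hJ W K hK hD3 hD4 hHN p hp2 hmult hsurj ⟨D, H, ι, hP⟩ hnt)

/-- **-w2's `missingUpperBoundAt_of_onlyMult_of_lowerTwists_of_jetchevAtP` with hJ♭**: the Euler-system half on «`p` the ONLY multiplicative prime»
(then `ord_p ∏_ℓ c_ℓ(E) ≤ ord_p c_p(E)`, -w2's `padicValNat_tamagawaProduct_le_of_onlyMult`). CONDITIONAL on hJ♭ and the twists' halves.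
-- adapted from Summits/BirchSwinnertonDyer/BirchSwinnertonDyer/Theorems/ErratumRoadFiveEulerHalfJetchevAtPDefect.lean (seat bsd-line-er5-p1-w2)
[cite: Jetchev2008, Cor. 1.5 (arXiv p. 3)] [cite: SilvermanAEC2009, Thm VII.6.1] -/
theorem missingUpperBoundAt_of_onlyMult_of_lowerTwists_of_hJflat
    (hGZ : ∀ (N : ℕ) [NeZero N] (W : WeierstrassCurve ℚ) (K : Type) [Field K] [NumberField K],
      gross_zagier N W K)
    (hKo : ∀ (N : ℕ) [NeZero N] (W : WeierstrassCurve ℚ) (K : Type) [Field K] [NumberField K],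
      kolyvagin N W K)
    (hGZK : rank_eq_analyticRank_of_analyticRank_le_one) (hmod : hasEntireLFunction_rat)
    (hnf : exists_isNewformOf) (hFH : friedbergHoffstein_exists_heegnerField_split_twist_ne_zero)
    (hMaz : mazur_not_dvd_maninConstant_of_odd)
    (hJ : JetchevAtPFlat)
    (W : WeierstrassCurve ℚ) [W.IsElliptic] [W.IsGloballyMinimal] (p : ℕ) [Fact p.Prime]
    (hmult : Mult W p) (hirr : Irr W p) (hsurj : Surj W p) (hp5 : 5 ≤ p) (hr : W.analyticRank = 1)
    (honly : ∀ (ℓ : ℕ) [Fact ℓ.Prime], W.HasMultiplicativeReductionAtPrime ℓ → ℓ = p)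
    (hlow : ∀ (K : Type) [Field K] [NumberField K] (Wd : WeierstrassCurve ℚ) [Wd.IsElliptic]
      [Wd.IsGloballyMinimal], IsImaginaryQuadratic K →
      SatisfiesHeegnerHypothesis (W.conductorNorm ℤ) K → SatisfiesHeegnerHypothesis p K →
      (∃ C : VariableChange ℚ, C • W.quadraticTwist (NumberField.discr K : ℚ) = Wd) →
      Wd.analyticRank = 0 → MissingLowerBoundAt Wd p) :
    Typed.MissingUpperBoundAt W p := by
  -- adapted from Summits/BirchSwinnertonDyer/BirchSwinnertonDyer/Theorems/ErratumRoadFiveEulerHalfJetchevAtPDefect.lean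
  haveI : NeZero (W.conductorNorm ℤ) := ⟨(W.conductorNorm_pos_holds).ne'⟩
  obtain ⟨q, hq, hle⟩ := padicValNat_shaOrder_add_le_of_rankOne_of_lowerTwists_of_hJflat hGZ hKo hGZK hmod hnf
    hFH hMaz hJ W p hmult hirr hsurj hp5 hr hlow
  have hT := padicValNat_tamagawaProduct_le_of_onlyMult W p hp5 honly
  refine ⟨q, hq, ?_⟩
  have hT' : (padicValNat p W.tamagawaProduct : ℤ) ≤
      padicValNat p ((W.baseChange ℚ_[p]).localTamagawaNumber ℤ_[p]) := by exact_mod_cast hT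
  omega

/-- **Plan g26's v1 piece S1 `stub_res_pOnlyMultAtFive` of the line of record — VERBATIM as conclusion — from `PublishedInputsFive`, `X11aLowerHalf`
and hJ♭** (-w2's `stub_res_pOnlyMultAtFive_of_jetchevAtP_of_items` re-run; the twists are X11a pairs by `X11b.classX11a_twist_of_not_ram`).
-- adapted from Summits/BirchSwinnertonDyer/BirchSwinnertonDyer/Theorems/ErratumRoadFiveEulerHalfPOnlyMultOfJetchevAtP.lean (seat bsd-line-er5-p1-w2)
[cite: Jetchev2008, Cor. 1.5 (arXiv p. 3)] [cite: Miller2011LMS, Def. 1.1] -/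
theorem res_pOnlyMultAtFive_of_hJflat_of_items (h₅ : PublishedInputsFive) (h₃ : X11aLowerHalf) (hJ : JetchevAtPFlat) :
    ∀ (W : WeierstrassCurve ℚ) [W.IsElliptic] [W.IsGloballyMinimal] (p : ℕ) [Fact p.Prime], ClassX11b W p → 5 ≤ p → Surj W p → ¬ Ram W p →
      p ∣ W.tamagawaProduct → (∀ (ℓ : ℕ) [Fact ℓ.Prime], W.HasMultiplicativeReductionAtPrime ℓ → ℓ = p) → Typed.MissingUpperBoundAt W p := by
  obtain ⟨hGZ, hKo, -, -, -, hGZK, hmod, hnf, -, hFHs, hMaz, -, -, -, -⟩ := h₅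
  intro W _ _ p _ hX hp5 hsurj hnram _ honly
  exact missingUpperBoundAt_of_onlyMult_of_lowerTwists_of_hJflat hGZ hKo hGZK hmod hnf hFHs hMaz hJ W p hX.2.2.1 hX.2.2.2
    hsurj hp5 hX.1 honly
    (fun K _ _ Wd _ _ hK hHN _ hC hrd ↦ by
      obtain ⟨C, hC⟩ := hC
      exact h₃ Wd p (X11b.classX11a_twist_of_not_ram W p hX hnram K hK hHN C hC hrd))

/-- **THE ROUTING, TYPED: the line of record's piece S1b (`Birth.Statement.res_pOnlyMultCarrierAtFive`, v2b′ ∕ v4 — the exceptional-zero core, 334 ∕ 404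
census pairs) — VERBATIM as conclusion — from the route items `PublishedInputsFive` + `X11aLowerHalf` and the JET column {K3, [McC] Cor. 5.6} ONLY.**
(The binders «p split», «p ∣ ord_pΔ_min», `p ∣ ∏c` are not used.) CONDITIONAL on K3 (reading; kernel-proved modulo named print + K5) and Cor. 5.6
(named print); nothing booked; 19715 not closed. [cite: Jetchev2008, Thm. 1.4, Cor. 1.5 (p. 812)] [cite: McCallumLMS1991, Cor. 5.6 (p. 310)] -/
theorem res_pOnlyMultCarrierAtFive_of_K3_of_mcCallum_of_items (h₅ : PublishedInputsFive) (h₃ : X11aLowerHalf)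
    (hK3 : Summit.BirchSwinnertonDyer.Rank1Residual.JET.JetchevDivisibilityCarrierMult)
    (hMcU : Literature.NumberTheory.EllipticCurves.McCallum1991_padicValNat_card_sha_primary_add_le_of_globalDivisibility) :
    ∀ (W : WeierstrassCurve ℚ) [W.IsElliptic] [W.IsGloballyMinimal] (p : ℕ) [Fact p.Prime], ClassX11b W p → 5 ≤ p → Surj W p → ¬ Ram W p →
      p ∣ W.tamagawaProduct → (∀ (ℓ : ℕ) [Fact ℓ.Prime], W.HasMultiplicativeReductionAtPrime ℓ → ℓ = p) → W.HasSplitMultiplicativeReductionAtPrime p →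
      p ∣ padicValInt p W.minimalDiscriminantInt → Typed.MissingUpperBoundAt W p := by
  intro W _ _ p _ hX hp5 hsurj hnram htam honly _ _
  exact res_pOnlyMultAtFive_of_hJflat_of_items h₅ h₃ (jetchevAtPFlat_of_K3_of_mcCallum h₅.2.1 hK3 hMcU) W p hX hp5 hsurj hnram htam honly

/-- **THE ROUTING, TYPED (K5 form — the port's content): S1b (`Birth.Statement.res_pOnlyMultCarrierAtFive`, 334 ∕ 404 census pairs) VERBATIM from the route
items `PublishedInputsFive` + `X11aLowerHalf`, the five PRINTED theorems `PrintedInputsJET`, and K5 `JET.JetchevCoreVertexExistence` ONLY.** Sorry-free.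
Read with plan g40's RULING 52′: the port's target (A) (HL at `p`, six printed facts, no core-vertex binder) and this theorem differ exactly by WHERE the
core-vertex walk is discharged — inside the ported AT-3 files (A), or once, `p`-generically, as K5 by name (here). CONDITIONAL on K5 + print; nothing
booked; 19715 not closed. [cite: Jetchev2008, Prop. 5.3, Thm. 1.4, Cor. 1.5] [cite: McCallumLMS1991, Cor. 5.6] -/
theorem res_pOnlyMultCarrierAtFive_of_K5_of_print_of_items (h₅ : PublishedInputsFive) (h₃ : X11aLowerHalf)
    (hP : PrintedInputsJET) (hK5 : Summit.BirchSwinnertonDyer.Rank1Residual.JET.JetchevCoreVertexExistence) :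
    ∀ (W : WeierstrassCurve ℚ) [W.IsElliptic] [W.IsGloballyMinimal] (p : ℕ) [Fact p.Prime], ClassX11b W p → 5 ≤ p → Surj W p → ¬ Ram W p →
      p ∣ W.tamagawaProduct → (∀ (ℓ : ℕ) [Fact ℓ.Prime], W.HasMultiplicativeReductionAtPrime ℓ → ℓ = p) → W.HasSplitMultiplicativeReductionAtPrime p →
      p ∣ padicValInt p W.minimalDiscriminantInt → Typed.MissingUpperBoundAt W p := by
  intro W _ _ p _ hX hp5 hsurj hnram htam honly _ _
  exact res_pOnlyMultAtFive_of_hJflat_of_items h₅ h₃ (jetchevAtPFlat_of_K5_of_print h₅.2.1 hP hK5) W p hX hp5 hsurj hnram htam honly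

/-! ## §4 The composition (sorry-free): two `closes` binders + the three stub STATEMENTS imply the crux, BY NAME -/

/-- **`EulerHalfNotRamNoInertSetAtFive_of`** — the crux BY NAME from `PublishedInputsFive` (item 19066) and `X11aLowerHalf` (item 19064) — both binders of
`closes` rev 46∕48 — and the statements of S0 (the five printed theorems `PrintedInputsJET`), S1 (K5 `JET.JetchevCoreVertexExistence`), S2 (residual by name): case split on «every multiplicative prime of `E` equals
`p`»; on that locus §3 (hJ♭ from §2); off it S2. Hypotheses = route items + declared stubs only (gate rule). -/
theorem EulerHalfNotRamNoInertSetAtFive_of (h₅ : PublishedInputsFive) (h₃ : X11aLowerHalf)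
    (hS0 : Statement.stub_printedInputsJET) (hS1 : Statement.stub_jetK5_coreVertex) (hS2 : Statement.stub_res_otherMultAtFive) :
    Summit.BirchSwinnertonDyer.BirchSwinnertonDyer.Theses.ErratumRoadFive.EulerHalfNotRamNoInertSetAtFive := by
  intro W _ _ p _ hX hp5 hsurj hnram htam hninert
  by_cases honly : ∀ (ℓ : ℕ) [Fact ℓ.Prime], W.HasMultiplicativeReductionAtPrime ℓ → ℓ = p
  · exact res_pOnlyMultAtFive_of_hJflat_of_items h₅ h₃ (jetchevAtPFlat_of_K5_of_print h₅.2.1 hS0 hS1) W p hX hp5 hsurj hnram htam honly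
  · have hex : ∃ ℓ : ℕ, ∃ _ : Fact ℓ.Prime, ℓ ≠ p ∧ W.HasMultiplicativeReductionAtPrime ℓ := by
      by_contra hne
      apply honly
      intro ℓ hℓ hm
      by_contra hℓp
      exact hne ⟨ℓ, hℓ, hℓp, hm⟩
    exact hS2 W p hX hp5 hsurj hnram htam hex hninert

/-- The crux along this line, MODULO exactly the three stubs (and the two route items it is handed): audit class proof-of-item. -/
theorem EulerHalfNotRamNoInertSetAtFive_proof (h₅ : PublishedInputsFive) (h₃ : X11aLowerHalf) :
    Summit.BirchSwinnertonDyer.BirchSwinnertonDyer.Theses.ErratumRoadFive.EulerHalfNotRamNoInertSetAtFive :=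
  EulerHalfNotRamNoInertSetAtFive_of h₅ h₃ stub_printedInputsJET stub_jetK5_coreVertex stub_res_otherMultAtFive

/-- Sanity: the crux decl is literally the route decl (rfl). -/
example : Summit.BirchSwinnertonDyer.BirchSwinnertonDyer.Theses.ErratumRoadFive.EulerHalfNotRamNoInertSetAtFive =
    Summit.BirchSwinnertonDyer.BirchSwinnertonDyer.Theses.ErratumRoadFive.EulerHalfNotRamNoInertSetAtFive := rfl

end Summit.BirchSwinnertonDyer.BirchSwinnertonDyer.Cruxes.EulerHalfNotRamNoInertSetAtFive.JetchevAtP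

end
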